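import Summits.QuantumFields.YangMills.Theorems.BalabanUVNodesN11TStepInnerPrivateCoordinateChart
import Summits.QuantumFields.YangMills.Theorems.BalabanUVNodesN11PrivateChartOfCentralWindow

/-!
# DAG node N11 — THE KERNEL-LEVEL SOCKET AT THE RECORD INHABITED BY THE INNER CHART ON THE CENTRAL α-WINDOW: def-T's (†) for ALL new sequences at once =
# `𝐓^{(k)}` (11a's `kernelRTOfRecord`) of the honest `dU_in`-integral over resampled INNER central bonds, with NO per-bond hypothesis — only the support clause on the inner bonds

HEADER — WORK-UNIT METADATA.  Cell `pub-ymgap`, YM-PLAN Track A (HUMAN RULING D-0062), seat `pub-ymgap-dag-n08-w2` (g9; WIDTH SEAT 2∕4 on N08 [B10], RE-POINTED to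
N11's [III] §3-supply residue), route `BalabanUVNodes`, key item K1⁷ `StabilityBAtRecordR13SepCoPH` = stmt-QuantumFields-20542 (helper lane, `--kind proof --supports 20542
--as helper` — jail key; K1⁹ stmt-QuantumFields-27364 is the K1-face of record, mis-key rule; count-neutral; (B4)-socket bookkeeping).  [I] = [Balaban1987RG1],
[III] = [Balaban1988Convergent].  FILE 11 of this seat's kernel-level socket (FILE 1 p611747 · FILE 3 p615387 · FILE 6 p624196 · FILE 8 p627313 · FILE 9 p629182
`…N11TStepInnerPrivateCoordinateChart` · FILE 10 `…N11TStepInCentralWindowChart`), second half of dag-n11-w6 g2's ASK-NEXT offer (o1) = the kernel-level ∕ ∀-s′ edition of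
their p629018 §3 `exists_innerChart_transportOfRecord_ae_eq_centralWindow`.  INHABITANT BY NAME: p629018 `exists_perBondCharts_centralWindow_ac` (per-bond bundle of the
central α-windows, no law displayed) ∕ `loops_small_of_plaqSmallOn_blocks`, over dag-n09-w6 g3's `N09CentralWindowAtRecord` and pub-balaban's local Stokes bound.

WHY THIS FILE.  FILE 9 inhabited FILE 6's record-level `hchart` with dag-n11-w6's INNER private-coordinate chart (resample only the central bonds `β(c)`, `c ∉ sV′`) and gave
def-T's (†) ∀ `s′` as `kernelRTOfRecord F N K k sV sV′ [∫ dU_in …]` — modulo DISPLAYED per-bond inversion data `(Ω, T, ϑ, j; hΩm hTm hθm hjm hΩbl hright hlaw)`.  On dag-n09-w6's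
CENTRAL α-WINDOW those data EXIST (p629018 §1); this file discharges them: THERE ARE jointly measurable `(T, ϑ, jd)` such that (§1) FILE 1's `hchart` holds for `avOfRecord` at
`(fieldMeasure k, fieldMeasure (k+1))` with the composite kernel «true conditional law outside ⊗ constant `Π_{sVᶜ} Haar` inside», inner chart `Ψ_in`, Jacobian `J` and the window
«every (0.4) loop variable of `U` at every coarse bond OFF `sV′` is `≤ α`», and (§2) for `dV′`-a.e. `V′` and EVERY `s′`,
`(𝐓e^A)_{k+1}(s′)(V′) = kernelRTOfRecord F N K k sV sV′ (y ↦ ∫ dU_in 𝟙[∀ c ∉ sV′, r c ∈ T_c]·∏ jd_c · (w(s′)(·,V′)·χ_k·T)(e_sV⁻¹(y, extend β′ (ϑ_c(·, r c))_c U_in))) o`, `(o, r) = e_α⁻¹V′`,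
modulo ONLY the SUPPORT CLAUSE on the INNER bonds «`w_k(s′)(U, V′) ≠ 0 ⇒ ∀ c ∉ sV′, ∀ i, dist1 (loopHol U c i) ≤ α`» (what (3.2)–(3.5) are meant to give there) and GRAPH
integrability; §3 = the same with the support clause in PLAQUETTE currency.  [III] (2.21)∕(3.1) «`∫dV_k|_{Ω^c_{k+1}} δ(V̄_k V_{k+1}⁻¹) … ∫dU|_{Ω_{k+1}} δ(…)`» with the INSIDE
δ-functions removed by SOLVING `Ū′(c) = V′(c)` on the central windows of the inside coarse bonds, outside by the TRUE conditional law — nothing displayed at the bonds.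

WHAT THIS FILE PROVES (0 `def`, 0 `sorry`, standard axioms; BY NAME over FILE 9 + p629018; `k < K`, `0 ≤ α ≤ 1∕24`, `α < δ_N`, `∀ c, offCard c∕|Idx| + 150α < 1`, `Y` saturated at
level `k+1`, `sV ⊇ bondsIn k Y`, `sV′ ⊆ bondsIn (k+1) Y`, `hβ′`; FILE 9's `hac_out` is DISCHARGED here by dag-n11-e's ★★ `map_pi_avgRestrOfRecord_absolutelyContinuous`).
§1 `innerWindow_centralWindow_eq` · ★★★ `exists_chart_avOfRecord_innerCentralWindow`.
§2 ★★★ `exists_ae_forall_tstepOfRecord_eq_kernelRTOfRecord_innerCentralWindow` · ★★ `exists_ae_forall_slotsTOfRecord₁₃H_succ_eq_kernelRTOfRecord_innerCentralWindow`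
(the represented tower's pre-𝐑 slots, Stage-13 letters — the LEFT side of (O3′) separated, nothing displayed at the bonds).
§3 ★ `exists_ae_forall_tstepOfRecord_eq_kernelRTOfRecord_of_plaqSmallInnerStepWeights`.

HONEST FRAMING.  Helper lane of K1⁷ (aside key); count-neutral; by-name composition; the SUPPORT CLAUSE on the inner bonds, `hβ′`, `hY`, `hsV`∕`hsV′` and the GRAPH integrability
REMAIN HYPOTHESES, displayed (`hac_out` follows from `hY`, `hsV`, `hsV′` by dag-n11-e's theorem and is no longer displayed); the Jacobian is a Radon–Nikodym VERSION; NO chart of Bałaban's ((47), [III] (3.10)–(3.25))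
asserted — a valid chart of the disintegration, not print's; nothing of Bałaban ([I] §2, [III] §3, Thm 1–2) asserted; (B4)∕(S-α)∕(O3′) NOT closed; N11 NOT discharged; N08
untouched; K1⁷∕K1⁸∕K1⁹ NOT closed, no registered stub touched; counts unmoved (typed 28∕28 · discharged 5∕27 · A 5∕28).  One finite `𝕋⁴_{L^K}` programme at fixed
`ε = L^{−K}`; R4 closes only the conditional finite-𝕋⁴ rung `BalabanLadder.UV` — NOT ℝ⁴, NOT OS, NOT a mass gap, NOT Clay.  No `sorry`, `axiom`, `def`, `instance`, `notation`.
Instance bookkeeping: FILE 9's `[DecidableEq (PBond …)]` binders are fed by the tree's global `instDecidableEqPBond` (as in p629018).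
Sources (SHAPE ∕ bookkeeping only): [I] (0.4) p.253, (2.4) p.266, (2.9)–(2.10) pp.266–267; [III] (2.17)–(2.18) p.257, (2.21) p.258, (3.1) p.264, (3.2)–(3.5) p.265, p.267 L18–24.
-/

noncomputable section

open MeasureTheory ProbabilityTheory Set Function
open scoped ENNReal NNReal

namespace Summit.QuantumFields.YangMills.Theorems.BalabanUVNodesN11TStepInnerCentralWindowChart

open Literature.MathematicalPhysics.QuantumFieldTheory.Balaban1983to89
open Literature.MathematicalPhysics.QuantumFieldTheory.Balaban1983to89.T4AveragingDisintegration
open Literature.MathematicalPhysics.QuantumFieldTheory.Balaban1983to89.BlockAveraging (Small Idx avgFun loopHol)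
open Literature.MathematicalPhysics.QuantumFieldTheory.Balaban1983to89.BlockAveragingHaarAC (centralBond pre post centralBond_injective isLocal_avgFun)
open Literature.MathematicalPhysics.QuantumFieldTheory.Balaban1983to89.BlockAveragingEMLHaarAC (fibreFamily offCard)
open Literature.MathematicalPhysics.QuantumFieldTheory.Balaban1983to89.ExpMeanLog (expMeanLogSU deltaSU)
open BalabanUVNodesN11TStepInnerPrivateCoordinateChart BalabanUVNodesN11PrivateChartOfCentralWindow
open BalabanUVNodesN11TransportOfRecordInPrivateCoordinateChart (succ_le_m_add_K)
open Summit.QuantumFields.YangMills.BalabanUVNodes.N09CentralWindowAtRecord (measurableSet_centralWindow self_mem_centralWindow_iff)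

section Record

open Node00 hiding SU
open T4Continuum
open B10Eq42TorusConstraint (bondsIn)
open B10Eq38TorusDomains (toFine)

variable {F : T4Family} {N : ℕ} [NeZero N] {K k : ℕ}

/-! ## §1  FILE 1's `hchart` for `avOfRecord` with the INNER step charted on the central α-windows of the coarse bonds OFF `sV′` -/

/-- In the glue coordinates at `sV`, the inner private-coordinate window of the central α-windows IS the inner small-loop region: for `q = (y, r)`,
«`∀ c ∉ sV′, r(β c) ∈ Ωα_c(e_sV⁻¹ q)`» `↔` «`∀ c ∉ sV′, ∀ i, dist1 (loopHol (e_sV⁻¹ q) c i) ≤ α`» (dag-n09-w6's `self_mem_centralWindow_iff`; `hβ′`: inside coarse bonds have inside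
central bonds). [cite: Balaban1987RG1, (0.4) p.253 and (2.9) p.266 (bookkeeping)] -/
theorem innerWindow_centralWindow_eq (hk : k < K) (α : ℝ) {sV : Finset (PBond (F.P K) k)} {sV' : Finset (PBond (F.P K) (k + 1))}
    (hβ' : ∀ c : PBond (F.P K) (k + 1), c ∉ sV' → centralBond c ∉ sV) :
    {q : (↥sV → SU N) × ({b : PBond (F.P K) k // b ∉ sV} → SU N) |
        ∀ c : {c : PBond (F.P K) (k + 1) // c ∉ sV'},
          q.2 ⟨centralBond (c : PBond (F.P K) (k + 1)), hβ' c c.2⟩ ∈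
            {g : SU N | ∀ i : Idx (F.P K), dist1 (fibreFamily ((MeasurableEquiv.piEquivPiSubtypeProd (fun _ : PBond (F.P K) k => SU N) (· ∈ sV)).symm q) c
              (pre ((MeasurableEquiv.piEquivPiSubtypeProd (fun _ : PBond (F.P K) k => SU N) (· ∈ sV)).symm q) c * g *
                post ((MeasurableEquiv.piEquivPiSubtypeProd (fun _ : PBond (F.P K) k => SU N) (· ∈ sV)).symm q) c) i) ≤ α}} =
      {q | ∀ c : {c : PBond (F.P K) (k + 1) // c ∉ sV'}, ∀ i : Idx (F.P K),
        dist1 (loopHol ((MeasurableEquiv.piEquivPiSubtypeProd (fun _ : PBond (F.P K) k => SU N) (· ∈ sV)).symm q) c i) ≤ α} := by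
  ext q
  simp only [Set.mem_setOf_eq]
  refine forall_congr' fun c => ?_
  have hq : ((MeasurableEquiv.piEquivPiSubtypeProd (fun _ : PBond (F.P K) k => SU N) (· ∈ sV)).symm q) (centralBond (c : PBond (F.P K) (k + 1))) =
      q.2 ⟨centralBond (c : PBond (F.P K) (k + 1)), hβ' c c.2⟩ := by
    rw [MeasurableEquiv.piEquivPiSubtypeProd_symm_apply]
    exact dif_neg (hβ' c c.2)
  have key := self_mem_centralWindow_iff (succ_le_m_add_K hk)
    ((MeasurableEquiv.piEquivPiSubtypeProd (fun _ : PBond (F.P K) k => SU N) (· ∈ sV)).symm q) (c : PBond (F.P K) (k + 1)) α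
  rw [Set.mem_setOf_eq, hq] at key
  exact key

/-- **★★★ THE KERNEL-LEVEL SOCKET AT THE RECORD, INHABITED BY THE INNER CHART ON THE CENTRAL α-WINDOW, NO PER-BOND HYPOTHESIS.**  At step `k < K`, for `0 ≤ α ≤ 1∕24`,
`α < δ_N`, `offCard c∕|Idx| + 150α < 1`, a fine region `Y` saturated at level `k+1` with bond sets `sV ⊇ bondsIn k Y`, `sV′ ⊆ bondsIn (k+1) Y` and `hβ′` (no `hac_out`: n11-e's ★★): THERE ARE
jointly measurable `(T, ϑ, jd)` such that with `X :=` the off-`sV` fine configurations, CONSTANT fibre kernel `Π_{sVᶜ} Haar`, inner chart `Ψ_in((y,v₂),r) := extend β′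
(c ↦ ϑ_c(e_sV⁻¹(y,r), v₂ c)) r`, Jacobian `J((y,v₂),r) := 𝟙[∀ c ∉ sV′, v₂ c ∈ T_c(e_sV⁻¹(y,r))]·∏_{c ∉ sV′} jd_c(e_sV⁻¹(y,r), v₂ c)` and the window «every (0.4) loop variable of `U`
at every coarse bond OFF `sV′` is `≤ α`», FILE 1's `hchart` holds for `(avOfRecord F N K k).avg` at `(fieldMeasure k, fieldMeasure (k+1))` — FILE 9 ★★★
`chart_avOfRecord_innerPrivateChart` at p629018 ★★★ `exists_perBondCharts_centralWindow_ac`.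
[cite: Balaban1987RG1, (0.4) p.253, (2.4) p.266, (2.9)–(2.10) pp.266–267; Balaban1988Convergent, (2.21) p.258, (3.1) p.264, (3.2)–(3.5) p.265, p.267 L18–24; Kechris1995, Thm 15.1] -/
theorem exists_chart_avOfRecord_innerCentralWindow (hkK : k < K) {α : ℝ} (hα0 : 0 ≤ α) (hα : α ≤ 1 / 24) (hαδ : α < deltaSU (Fin N))
    (hgap : ∀ c : PBond (F.P K) (k + 1), (offCard c : ℝ) / (Fintype.card (Idx (F.P K)) : ℝ) + 150 * α < 1)
    {Y : Set (Site (F.P K) 0)} (hY : ∀ s : Site (F.P K) k, toFine k s ∈ Y ↔ toFine (k + 1) (blockOf s) ∈ Y)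
    {sV : Finset (PBond (F.P K) k)} (hsV : ∀ b : PBond (F.P K) k, b ∈ bondsIn k Y → b ∈ sV)
    {sV' : Finset (PBond (F.P K) (k + 1))} (hsV' : ∀ c : PBond (F.P K) (k + 1), c ∈ sV' → c ∈ bondsIn (k + 1) Y)
    (hβ' : ∀ c : PBond (F.P K) (k + 1), c ∉ sV' → centralBond c ∉ sV) :
    ∃ (T : PBond (F.P K) (k + 1) → GaugeField (F.P K) k (SU N) → Set (SU N))
      (ϑ : PBond (F.P K) (k + 1) → GaugeField (F.P K) k (SU N) → SU N → SU N)
      (jd : PBond (F.P K) (k + 1) → GaugeField (F.P K) k (SU N) → SU N → ℝ≥0),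
      (∀ c, MeasurableSet {p : GaugeField (F.P K) k (SU N) × SU N | p.2 ∈ T c p.1}) ∧
      (∀ c, Measurable fun p : GaugeField (F.P K) k (SU N) × SU N => ϑ c p.1 p.2) ∧
      (∀ c, Measurable fun p : GaugeField (F.P K) k (SU N) × SU N => jd c p.1 p.2) ∧
      (((fieldMeasure (F.P K) (k + 1) (SU N)) ⊗ₘ
        (Kernel.comap
          ((Kernel.withDensity
              (condLaw ((Measure.pi fun _ : ↥sV => (HaarData.haar : Measure (SU N))).prod
                (Measure.pi fun _ : {c : PBond (F.P K) (k + 1) // c ∉ sV'} => (HaarData.haar : Measure (SU N))))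
                (Prod.map (avgRestrOfRecord F N K k sV sV') id))
              fun v _ => (margDensity ((Measure.pi fun _ : ↥sV => (HaarData.haar : Measure (SU N))).prod
                  (Measure.pi fun _ : {c : PBond (F.P K) (k + 1) // c ∉ sV'} => (HaarData.haar : Measure (SU N))))
                ((Measure.pi fun _ : ↥sV' => (HaarData.haar : Measure (SU N))).prod
                  (Measure.pi fun _ : {c : PBond (F.P K) (k + 1) // c ∉ sV'} => (HaarData.haar : Measure (SU N))))
                (Prod.map (avgRestrOfRecord F N K k sV sV') id) v : ℝ≥0∞)) ⊗ₖ
            Kernel.prodMkLeft ((↥sV' → SU N) × ({c : PBond (F.P K) (k + 1) // c ∉ sV'} → SU N))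
              (Kernel.const ((↥sV → SU N) × ({c : PBond (F.P K) (k + 1) // c ∉ sV'} → SU N))
                (Measure.pi fun _ : {b : PBond (F.P K) k // b ∉ sV} => (HaarData.haar : Measure (SU N)))))
          (MeasurableEquiv.piEquivPiSubtypeProd (fun _ : PBond (F.P K) (k + 1) => SU N) (· ∈ sV'))
          (MeasurableEquiv.piEquivPiSubtypeProd (fun _ : PBond (F.P K) (k + 1) => SU N) (· ∈ sV')).measurable)).withDensity
        (fun z => (({z : ((↥sV → SU N) × ({c : PBond (F.P K) (k + 1) // c ∉ sV'} → SU N)) × ({b : PBond (F.P K) k // b ∉ sV} → SU N) |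
              ∀ c : {c : PBond (F.P K) (k + 1) // c ∉ sV'},
                z.1.2 c ∈ T c ((MeasurableEquiv.piEquivPiSubtypeProd (fun _ : PBond (F.P K) k => SU N) (· ∈ sV)).symm (z.1.1, z.2))}.indicator
            (fun z => ∏ c : {c : PBond (F.P K) (k + 1) // c ∉ sV'},
              jd c ((MeasurableEquiv.piEquivPiSubtypeProd (fun _ : PBond (F.P K) k => SU N) (· ∈ sV)).symm (z.1.1, z.2)) (z.1.2 c)) z.2 : ℝ≥0) : ℝ≥0∞))).map
        (fun z => (z.1, (MeasurableEquiv.piEquivPiSubtypeProd (fun _ : PBond (F.P K) k => SU N) (· ∈ sV)).symm (z.2.1.1,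
          extend (fun c : {c : PBond (F.P K) (k + 1) // c ∉ sV'} =>
              (⟨centralBond (c : PBond (F.P K) (k + 1)), hβ' c c.2⟩ : {b : PBond (F.P K) k // b ∉ sV}))
            (fun c : {c : PBond (F.P K) (k + 1) // c ∉ sV'} =>
              ϑ c ((MeasurableEquiv.piEquivPiSubtypeProd (fun _ : PBond (F.P K) k => SU N) (· ∈ sV)).symm (z.2.1.1, z.2.2)) (z.2.1.2 c)) z.2.2))) =
      (jointLaw (fieldMeasure (F.P K) k (SU N)) (avOfRecord F N K k).avg).restrict
        {w : GaugeField (F.P K) (k + 1) (SU N) × GaugeField (F.P K) k (SU N) |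
          (((MeasurableEquiv.piEquivPiSubtypeProd (fun _ : PBond (F.P K) k => SU N) (· ∈ sV) w.2).1,
              fun c : {c : PBond (F.P K) (k + 1) // c ∉ sV'} => (avOfRecord F N K k).avg w.2 c),
            MeasurableEquiv.piEquivPiSubtypeProd (fun _ : PBond (F.P K) k => SU N) (· ∈ sV) w.2) ∈
          (Prod.snd ⁻¹' {q : (↥sV → SU N) × ({b : PBond (F.P K) k // b ∉ sV} → SU N) |
            ∀ c : {c : PBond (F.P K) (k + 1) // c ∉ sV'}, ∀ i : Idx (F.P K),
              dist1 (loopHol ((MeasurableEquiv.piEquivPiSubtypeProd (fun _ : PBond (F.P K) k => SU N) (· ∈ sV)).symm q) c i) ≤ α} :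
            Set (((↥sV → SU N) × ({c : PBond (F.P K) (k + 1) // c ∉ sV'} → SU N)) × ((↥sV → SU N) × ({b : PBond (F.P K) k // b ∉ sV} → SU N))))} := by
  obtain ⟨T, ϑ, jd, hΩm, hΩbl, hTm, hθm, hjm, hright, hlaw, -, -, -⟩ :=
    exists_perBondCharts_centralWindow_ac (F := F) (N := N) hkK hα0 hα hαδ hgap
  -- `hac_out` is n11-e's ★★ `map_pi_avgRestrOfRecord_absolutelyContinuous` at `(hY, hsV, hsV′)` — discharged, not displayed
  have hac_out := map_pi_avgRestrOfRecord_absolutelyContinuous F N K k (succ_le_m_add_K hkK) hY hsV hsV'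
  refine ⟨T, ϑ, jd, hTm, hθm, hjm, ?_⟩
  rw [← innerWindow_centralWindow_eq (F := F) (N := N) hkK α hβ']
  exact chart_avOfRecord_innerPrivateChart (fun c U => {g : SU N | ∀ i : Idx (F.P K), dist1 (fibreFamily U c (pre U c * g * post U c) i) ≤ α})
    T ϑ jd hkK hY hsV hsV' hβ' hac_out hΩm hTm hθm hjm hΩbl hright hlaw

end Record

/-! ## §2  def-T's (†) FOR ALL NEW SEQUENCES AT ONCE = `𝐓^{(k)}` (11a's `kernelRTOfRecord`) of the INNER central-window chart integral — support clause on the inner bonds only -/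

section TStep

open Node00 hiding SU
open T4Continuum
open B10Eq42TorusConstraint (bondsIn)
open B10Eq38TorusDomains (toFine)

variable {F : T4Family} {N : ℕ} [NeZero N] (p : B12.RunParams) {k : ℕ}

/-- **★★★ def-T's (†) AT THE RECORD = 11a's RESTRICTED TRANSPORT OF THE INNER CENTRAL-WINDOW CHART INTEGRAL, ALL `s′` AT ONCE, NO PER-BOND HYPOTHESIS**: at step `k < p.K`, for
`0 ≤ α ≤ 1∕24`, `α < δ_N`, `offCard c∕|Idx| + 150α < 1`, a fine region `Y` saturated at level `k+1` with bond sets `sV ⊇ bondsIn k Y`, `sV′ ⊆ bondsIn (k+1) Y`, `hβ′` (no `hac_out`), step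
weights with measurable sections and the SUPPORT CLAUSE ON THE INNER BONDS «`w_k(s′)(U, V′) ≠ 0 ⇒ ∀ c ∉ sV′, ∀ i, dist1 (loopHol U c i) ≤ α`» ((3.2)–(3.5) — DISPLAYED), measurable
`χ_k(s)`, `T(s)` and GRAPH-integrable (†) integrands: THERE ARE jointly measurable `(T, ϑ, jd)` such that for `dV′`-a.e. `V′` and EVERY `s′`, with `(o, r) := e_α⁻¹V′`, `e = e_sV⁻¹`,
`(𝐓e^A)_{k+1}(s′)(V′) = kernelRTOfRecord F N K k sV sV′ (y ↦ ∫ dU_in 𝟙[∀ c ∉ sV′, r c ∈ T_c(e(y,U_in))]·∏_{c ∉ sV′} jd_c(e(y,U_in), r c) · (w(s′)(·,V′)·χ_k·T)(e(y, extend β′ (ϑ_c(e(y,U_in), r c))_c U_in))) o`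
— FILE 9 ★★★ `ae_forall_tstepOfRecord_eq_kernelRTOfRecord_innerPrivateChart` at p629018's bundle: [III] (2.21)∕(3.1) with the inside δ-functions removed by SOLVING `Ū′(c) = V′(c)` on
dag-n09-w6's central windows, outside by the TRUE conditional law.
[cite: Balaban1988Convergent, (2.18) p.257, (2.21) p.258, (3.1) p.264, (3.2)–(3.5) p.265, p.267 L18–24; Balaban1987RG1, (0.4) p.253, (2.9)–(2.10) pp.266–267] -/
theorem exists_ae_forall_tstepOfRecord_eq_kernelRTOfRecord_innerCentralWindow
    (ν : Stage7Numerics) (M : ℕ) (w : StepWeightsOfRecord F N ν M) (g : ℕ → ℝ) (hk : k < p.K) (T' : SeqOfRecord F ν M g p.K k → Density (F.P p.K) k (SU N))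
    {α : ℝ} (hα0 : 0 ≤ α) (hα : α ≤ 1 / 24) (hαδ : α < deltaSU (Fin N))
    (hgap : ∀ c : PBond (F.P p.K) (k + 1), (offCard c : ℝ) / (Fintype.card (Idx (F.P p.K)) : ℝ) + 150 * α < 1)
    {Y : Set (Site (F.P p.K) 0)} (hY : ∀ s : Site (F.P p.K) k, toFine k s ∈ Y ↔ toFine (k + 1) (blockOf s) ∈ Y)
    {sV : Finset (PBond (F.P p.K) k)} (hsV : ∀ b : PBond (F.P p.K) k, b ∈ bondsIn k Y → b ∈ sV)
    {sV' : Finset (PBond (F.P p.K) (k + 1))} (hsV' : ∀ c : PBond (F.P p.K) (k + 1), c ∈ sV' → c ∈ bondsIn (k + 1) Y)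
    (hβ' : ∀ c : PBond (F.P p.K) (k + 1), c ∉ sV' → centralBond c ∉ sV)
    (hw : ∀ s' V', Measurable fun U => w p g k s' U V') (hwj : ∀ s', Measurable fun q : GaugeField (F.P p.K) (k + 1) (SU N) × GaugeField (F.P p.K) k (SU N) =>
      w p g k s' q.2 q.1)
    (hχ : ∀ s, Measurable (chiSeqOfRecord F N ν M g p.K k s)) (hT : ∀ s, Measurable (T' s))
    (hwS : ∀ s' (U : GaugeField (F.P p.K) k (SU N)) V', w p g k s' U V' ≠ 0 → ∀ c : PBond (F.P p.K) (k + 1), c ∉ sV' →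
      ∀ i : Idx (F.P p.K), dist1 (loopHol U c i) ≤ α)
    (hGi : ∀ s' : SeqOfRecord F ν M g p.K (k + 1),
      Integrable (fun U => w p g k s' U ((avOfRecord F N p.K k).avg U) * (chiSeqOfRecord F N ν M g p.K k s'.init U * T' s'.init U))
        (fieldMeasure (F.P p.K) k (SU N))) :
    ∃ (T : PBond (F.P p.K) (k + 1) → GaugeField (F.P p.K) k (SU N) → Set (SU N))
      (ϑ : PBond (F.P p.K) (k + 1) → GaugeField (F.P p.K) k (SU N) → SU N → SU N)
      (jd : PBond (F.P p.K) (k + 1) → GaugeField (F.P p.K) k (SU N) → SU N → ℝ≥0),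
      (∀ c, MeasurableSet {q : GaugeField (F.P p.K) k (SU N) × SU N | q.2 ∈ T c q.1}) ∧
      (∀ c, Measurable fun q : GaugeField (F.P p.K) k (SU N) × SU N => ϑ c q.1 q.2) ∧
      (∀ c, Measurable fun q : GaugeField (F.P p.K) k (SU N) × SU N => jd c q.1 q.2) ∧
      ∀ᵐ V' ∂(fieldMeasure (F.P p.K) (k + 1) (SU N)), ∀ s' : SeqOfRecord F ν M g p.K (k + 1),
        tstepOfRecord F N ν M w p g k T' s' V' =
          kernelRTOfRecord F N p.K k sV sV'
            (fun y => ∫ uin,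
              (({z : ((↥sV → SU N) × ({c : PBond (F.P p.K) (k + 1) // c ∉ sV'} → SU N)) × ({b : PBond (F.P p.K) k // b ∉ sV} → SU N) |
                  ∀ c : {c : PBond (F.P p.K) (k + 1) // c ∉ sV'},
                    z.1.2 c ∈ T c ((MeasurableEquiv.piEquivPiSubtypeProd (fun _ : PBond (F.P p.K) k => SU N) (· ∈ sV)).symm (z.1.1, z.2))}.indicator
                (fun z => ∏ c : {c : PBond (F.P p.K) (k + 1) // c ∉ sV'},
                  jd c ((MeasurableEquiv.piEquivPiSubtypeProd (fun _ : PBond (F.P p.K) k => SU N) (· ∈ sV)).symm (z.1.1, z.2)) (z.1.2 c))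
                ((y, (MeasurableEquiv.piEquivPiSubtypeProd (fun _ : PBond (F.P p.K) (k + 1) => SU N) (· ∈ sV') V').2), uin) : ℝ≥0) : ℝ) *
              ((fun U : GaugeField (F.P p.K) k (SU N) => w p g k s' U V' * (chiSeqOfRecord F N ν M g p.K k s'.init U * T' s'.init U))
                ((MeasurableEquiv.piEquivPiSubtypeProd (fun _ : PBond (F.P p.K) k => SU N) (· ∈ sV)).symm (y,
                  extend (fun c : {c : PBond (F.P p.K) (k + 1) // c ∉ sV'} =>
                      (⟨centralBond (c : PBond (F.P p.K) (k + 1)), hβ' c c.2⟩ : {b : PBond (F.P p.K) k // b ∉ sV}))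
                    (fun c : {c : PBond (F.P p.K) (k + 1) // c ∉ sV'} =>
                      ϑ c ((MeasurableEquiv.piEquivPiSubtypeProd (fun _ : PBond (F.P p.K) k => SU N) (· ∈ sV)).symm (y, uin))
                        ((MeasurableEquiv.piEquivPiSubtypeProd (fun _ : PBond (F.P p.K) (k + 1) => SU N) (· ∈ sV') V').2 c)) uin)))
              ∂(Measure.pi fun _ : {b : PBond (F.P p.K) k // b ∉ sV} => (HaarData.haar : Measure (SU N))))
            (MeasurableEquiv.piEquivPiSubtypeProd (fun _ : PBond (F.P p.K) (k + 1) => SU N) (· ∈ sV') V').1 := by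
  have hkr : k + 1 ≤ (F.P p.K).m + (F.P p.K).K := succ_le_m_add_K hk
  obtain ⟨T, ϑ, jd, hΩm, hΩbl, hTm, hθm, hjm, hright, hlaw, -, -, -⟩ :=
    exists_perBondCharts_centralWindow_ac (F := F) (N := N) hk hα0 hα hαδ hgap
  have hac_out := map_pi_avgRestrOfRecord_absolutelyContinuous F N p.K k hkr hY hsV hsV'
  exact ⟨T, ϑ, jd, hTm, hθm, hjm, ae_forall_tstepOfRecord_eq_kernelRTOfRecord_innerPrivateChart p
    (fun c U => {g' : SU N | ∀ i : Idx (F.P p.K), dist1 (fibreFamily U c (pre U c * g' * post U c) i) ≤ α})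
    T ϑ jd ν M w g hk T' hY hsV hsV' hβ' hac_out hΩm hTm hθm hjm hΩbl hright hlaw hw hwj hχ hT
    (fun s' U V' h c hc => (self_mem_centralWindow_iff hkr U c α).2 (hwS s' U V' h c hc)) hGi⟩

/-- **★★ THE REPRESENTED TOWER'S PRE-𝐑 SLOTS AT LEVEL k+1, SEPARATED, ON THE CENTRAL α-WINDOW, STAGE-13 LETTERS, EVERY HISTORY AT ONCE** (the LEFT side of N11's
𝐓-present child obligation (O3′) in `kernelRTOfRecord` currency «with the inside δ-functions removed», no per-bond hypothesis): at a v1.7 parameter `θ`, `k < K`, small `α`,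
a saturated `Y` with `sV ⊇ bondsIn k Y`, `sV′ ⊆ bondsIn (k+1) Y`, `hβ′`, def-K0a's step weights of record with measurable sections, the SUPPORT CLAUSE ON THE INNER BONDS
«`w_k(s)(U, V′) ≠ 0 ⇒ ∀ c ∉ sV′, ∀ i, dist1 (loopHol U c i) ≤ α`», measurable `χ_k(s₀)`, `slot_k(s₀)` and GRAPH-integrable slot integrands: THERE ARE jointly measurable
`(T, ϑ, jd)` such that for `dV′`-a.e. `V′` and every length-(k+1) history `s`, `slotsT_{k+1}(s)(V′) = kernelRTOfRecord F N K k sV sV′ [y ↦ ∫ dU_in 𝟙·∏ jd ·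
(w_k(s)(·,V′)·χ_k(init s)·slot_k(init s))(e_sV⁻¹(y, extend β′ (ϑ_c(·, r c))_c U_in))] o` — ★★★ above at `T := slot_k`, `w := wOfRecord₉` (def-T's `slotsTOfRecord_succ` is `rfl`).
[cite: Balaban1988Convergent, (2.21) p.258, (3.1) p.264, (3.2)–(3.5) p.265, p.267 L18–24, (3.24)–(3.25) p.270; Balaban1987RG1, (0.4) p.253, (2.9)–(2.10) pp.266–267] -/
theorem exists_ae_forall_slotsTOfRecord₁₃H_succ_eq_kernelRTOfRecord_innerCentralWindow (θ : Stage13HParams F N) (hk : k < p.K)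
    {α : ℝ} (hα0 : 0 ≤ α) (hα : α ≤ 1 / 24) (hαδ : α < deltaSU (Fin N))
    (hgap : ∀ c : PBond (F.P p.K) (k + 1), (offCard c : ℝ) / (Fintype.card (Idx (F.P p.K)) : ℝ) + 150 * α < 1)
    {Y : Set (Site (F.P p.K) 0)} (hY : ∀ s : Site (F.P p.K) k, toFine k s ∈ Y ↔ toFine (k + 1) (blockOf s) ∈ Y)
    {sV : Finset (PBond (F.P p.K) k)} (hsV : ∀ b : PBond (F.P p.K) k, b ∈ bondsIn k Y → b ∈ sV)
    {sV' : Finset (PBond (F.P p.K) (k + 1))} (hsV' : ∀ c : PBond (F.P p.K) (k + 1), c ∈ sV' → c ∈ bondsIn (k + 1) Y)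
    (hβ' : ∀ c : PBond (F.P p.K) (k + 1), c ∉ sV' → centralBond c ∉ sV)
    (hw : ∀ (s : SeqOfRecord F θ.ν θ.τ9.M (gOfRecord₁₃ F N θ.toStage13Params p) p.K (k + 1)) (V' : GaugeField (F.P p.K) (k + 1) (SU N)),
      Measurable fun U => wOfRecord₉ F N θ.toStage9Params p (gOfRecord₁₃ F N θ.toStage13Params p) k s U V')
    (hwj : ∀ s : SeqOfRecord F θ.ν θ.τ9.M (gOfRecord₁₃ F N θ.toStage13Params p) p.K (k + 1),
      Measurable fun q : GaugeField (F.P p.K) (k + 1) (SU N) × GaugeField (F.P p.K) k (SU N) =>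
        wOfRecord₉ F N θ.toStage9Params p (gOfRecord₁₃ F N θ.toStage13Params p) k s q.2 q.1)
    (hχ : ∀ s₀ : SeqOfRecord F θ.ν θ.τ9.M (gOfRecord₁₃ F N θ.toStage13Params p) p.K k,
      Measurable (chiSeqOfRecord F N θ.ν θ.τ9.M (gOfRecord₁₃ F N θ.toStage13Params p) p.K k s₀))
    (hslot : ∀ s₀ : SeqOfRecord F θ.ν θ.τ9.M (gOfRecord₁₃ F N θ.toStage13Params p) p.K k,
      Measurable (slotsOfRecord F N θ.ν θ.τ9 (EOfRecord₁₃ F N θ.toStage13Params) (wOfRecord₉ F N θ.toStage9Params) θ.ppSel p (gOfRecord₁₃ F N θ.toStage13Params p) k s₀))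
    (hwS : ∀ (s : SeqOfRecord F θ.ν θ.τ9.M (gOfRecord₁₃ F N θ.toStage13Params p) p.K (k + 1)) (U : GaugeField (F.P p.K) k (SU N))
      (V' : GaugeField (F.P p.K) (k + 1) (SU N)),
      wOfRecord₉ F N θ.toStage9Params p (gOfRecord₁₃ F N θ.toStage13Params p) k s U V' ≠ 0 → ∀ c : PBond (F.P p.K) (k + 1), c ∉ sV' →
        ∀ i : Idx (F.P p.K), dist1 (loopHol U c i) ≤ α)
    (hGi : ∀ s : SeqOfRecord F θ.ν θ.τ9.M (gOfRecord₁₃ F N θ.toStage13Params p) p.K (k + 1),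
      Integrable (fun U => wOfRecord₉ F N θ.toStage9Params p (gOfRecord₁₃ F N θ.toStage13Params p) k s U ((avOfRecord F N p.K k).avg U) *
        (chiSeqOfRecord F N θ.ν θ.τ9.M (gOfRecord₁₃ F N θ.toStage13Params p) p.K k s.init U *
          slotsOfRecord F N θ.ν θ.τ9 (EOfRecord₁₃ F N θ.toStage13Params) (wOfRecord₉ F N θ.toStage9Params) θ.ppSel p (gOfRecord₁₃ F N θ.toStage13Params p) k s.init U))
        (fieldMeasure (F.P p.K) k (SU N))) :
    ∃ (T : PBond (F.P p.K) (k + 1) → GaugeField (F.P p.K) k (SU N) → Set (SU N))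
      (ϑ : PBond (F.P p.K) (k + 1) → GaugeField (F.P p.K) k (SU N) → SU N → SU N)
      (jd : PBond (F.P p.K) (k + 1) → GaugeField (F.P p.K) k (SU N) → SU N → ℝ≥0),
      (∀ c, MeasurableSet {q : GaugeField (F.P p.K) k (SU N) × SU N | q.2 ∈ T c q.1}) ∧
      (∀ c, Measurable fun q : GaugeField (F.P p.K) k (SU N) × SU N => ϑ c q.1 q.2) ∧
      (∀ c, Measurable fun q : GaugeField (F.P p.K) k (SU N) × SU N => jd c q.1 q.2) ∧
      ∀ᵐ V' ∂(fieldMeasure (F.P p.K) (k + 1) (SU N)), ∀ s : SeqOfRecord F θ.ν θ.τ9.M (gOfRecord₁₃ F N θ.toStage13Params p) p.K (k + 1),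
        slotsTOfRecord F N θ.ν θ.τ9 (EOfRecord₁₃ F N θ.toStage13Params) (wOfRecord₉ F N θ.toStage9Params) θ.ppSel p (gOfRecord₁₃ F N θ.toStage13Params p) (k + 1) s V' =
          kernelRTOfRecord F N p.K k sV sV'
            (fun y => ∫ uin,
              (({z : ((↥sV → SU N) × ({c : PBond (F.P p.K) (k + 1) // c ∉ sV'} → SU N)) × ({b : PBond (F.P p.K) k // b ∉ sV} → SU N) |
                  ∀ c : {c : PBond (F.P p.K) (k + 1) // c ∉ sV'},
                    z.1.2 c ∈ T c ((MeasurableEquiv.piEquivPiSubtypeProd (fun _ : PBond (F.P p.K) k => SU N) (· ∈ sV)).symm (z.1.1, z.2))}.indicator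
                (fun z => ∏ c : {c : PBond (F.P p.K) (k + 1) // c ∉ sV'},
                  jd c ((MeasurableEquiv.piEquivPiSubtypeProd (fun _ : PBond (F.P p.K) k => SU N) (· ∈ sV)).symm (z.1.1, z.2)) (z.1.2 c))
                ((y, (MeasurableEquiv.piEquivPiSubtypeProd (fun _ : PBond (F.P p.K) (k + 1) => SU N) (· ∈ sV') V').2), uin) : ℝ≥0) : ℝ) *
              ((fun U : GaugeField (F.P p.K) k (SU N) =>
                  wOfRecord₉ F N θ.toStage9Params p (gOfRecord₁₃ F N θ.toStage13Params p) k s U V' *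
                    (chiSeqOfRecord F N θ.ν θ.τ9.M (gOfRecord₁₃ F N θ.toStage13Params p) p.K k s.init U *
                      slotsOfRecord F N θ.ν θ.τ9 (EOfRecord₁₃ F N θ.toStage13Params) (wOfRecord₉ F N θ.toStage9Params) θ.ppSel p
                        (gOfRecord₁₃ F N θ.toStage13Params p) k s.init U))
                ((MeasurableEquiv.piEquivPiSubtypeProd (fun _ : PBond (F.P p.K) k => SU N) (· ∈ sV)).symm (y,
                  extend (fun c : {c : PBond (F.P p.K) (k + 1) // c ∉ sV'} =>
                      (⟨centralBond (c : PBond (F.P p.K) (k + 1)), hβ' c c.2⟩ : {b : PBond (F.P p.K) k // b ∉ sV}))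
                    (fun c : {c : PBond (F.P p.K) (k + 1) // c ∉ sV'} =>
                      ϑ c ((MeasurableEquiv.piEquivPiSubtypeProd (fun _ : PBond (F.P p.K) k => SU N) (· ∈ sV)).symm (y, uin))
                        ((MeasurableEquiv.piEquivPiSubtypeProd (fun _ : PBond (F.P p.K) (k + 1) => SU N) (· ∈ sV') V').2 c)) uin)))
              ∂(Measure.pi fun _ : {b : PBond (F.P p.K) k // b ∉ sV} => (HaarData.haar : Measure (SU N))))
            (MeasurableEquiv.piEquivPiSubtypeProd (fun _ : PBond (F.P p.K) (k + 1) => SU N) (· ∈ sV') V').1 := by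
  obtain ⟨T, ϑ, jd, hTm, hθm, hjm, h⟩ := exists_ae_forall_tstepOfRecord_eq_kernelRTOfRecord_innerCentralWindow p θ.ν θ.τ9.M
    (wOfRecord₉ F N θ.toStage9Params) (gOfRecord₁₃ F N θ.toStage13Params p) hk
    (slotsOfRecord F N θ.ν θ.τ9 (EOfRecord₁₃ F N θ.toStage13Params) (wOfRecord₉ F N θ.toStage9Params) θ.ppSel p (gOfRecord₁₃ F N θ.toStage13Params p) k)
    hα0 hα hαδ hgap hY hsV hsV' hβ' hw hwj hχ hslot hwS hGi
  refine ⟨T, ϑ, jd, hTm, hθm, hjm, ?_⟩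
  filter_upwards [h] with V' hV' s
  rw [slotsTOfRecord_succ]
  exact hV' s

/-! ## §3  The inner support clause in PLAQUETTE currency -/

/-- **★ def-T's (†) = `kernelRTOfRecord` OF THE INNER CENTRAL-WINDOW CHART INTEGRAL, WITH THE SUPPORT CLAUSE IN PLAQUETTE CURRENCY**: as ★★★
`exists_ae_forall_tstepOfRecord_eq_kernelRTOfRecord_innerCentralWindow`, the support clause now reading «wherever `w(s′)(U, V′) ≠ 0`, at every coarse bond `c ∉ sV′` every fine
plaquette based in the three blocks `B(c₋ − e_μ) ∪ B(c₋) ∪ B(c₊)` is within `δ` of `1`», `0 ≤ δ`, `((d+2)L)²∕4 · δ ≤ α` — the shape in which the INSIDE small-field characteristic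
functions (2.17) ∕ (3.3) constrain the step weights (p629018 `loops_small_of_plaqSmallOn_blocks` = pub-balaban's local Stokes bound).
[cite: Balaban1988Convergent, (2.17) p.257, (2.21) p.258, (3.1) p.264, (3.3) p.265, p.267 L18–24; Balaban1987RG1, (0.4) p.253, (2.9) p.266] -/
theorem exists_ae_forall_tstepOfRecord_eq_kernelRTOfRecord_of_plaqSmallInnerStepWeights
    (ν : Stage7Numerics) (M : ℕ) (w : StepWeightsOfRecord F N ν M) (g : ℕ → ℝ) (hk : k < p.K) (T' : SeqOfRecord F ν M g p.K k → Density (F.P p.K) k (SU N))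
    {α : ℝ} (hα0 : 0 ≤ α) (hα : α ≤ 1 / 24) (hαδ : α < deltaSU (Fin N))
    (hgap : ∀ c : PBond (F.P p.K) (k + 1), (offCard c : ℝ) / (Fintype.card (Idx (F.P p.K)) : ℝ) + 150 * α < 1)
    {δ : ℝ} (hδ : 0 ≤ δ) (hδα : ((((F.P p.K).d + 2) * (F.P p.K).L : ℕ) : ℝ) ^ 2 / 4 * δ ≤ α)
    {Y : Set (Site (F.P p.K) 0)} (hY : ∀ s : Site (F.P p.K) k, toFine k s ∈ Y ↔ toFine (k + 1) (blockOf s) ∈ Y)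
    {sV : Finset (PBond (F.P p.K) k)} (hsV : ∀ b : PBond (F.P p.K) k, b ∈ bondsIn k Y → b ∈ sV)
    {sV' : Finset (PBond (F.P p.K) (k + 1))} (hsV' : ∀ c : PBond (F.P p.K) (k + 1), c ∈ sV' → c ∈ bondsIn (k + 1) Y)
    (hβ' : ∀ c : PBond (F.P p.K) (k + 1), c ∉ sV' → centralBond c ∉ sV)
    (hw : ∀ s' V', Measurable fun U => w p g k s' U V') (hwj : ∀ s', Measurable fun q : GaugeField (F.P p.K) (k + 1) (SU N) × GaugeField (F.P p.K) k (SU N) =>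
      w p g k s' q.2 q.1)
    (hχ : ∀ s, Measurable (chiSeqOfRecord F N ν M g p.K k s)) (hT : ∀ s, Measurable (T' s))
    (hwq : ∀ s' (U : GaugeField (F.P p.K) k (SU N)) V', w p g k s' U V' ≠ 0 → ∀ c : PBond (F.P p.K) (k + 1), c ∉ sV' → ∀ q : Plaq (F.P p.K) k,
      (blockOf q.src = c.src.unshift c.dir ∨ blockOf q.src = c.src ∨ blockOf q.src = c.tgt) → dist1 (GaugeField.plaqHol U q) < δ)
    (hGi : ∀ s' : SeqOfRecord F ν M g p.K (k + 1),
      Integrable (fun U => w p g k s' U ((avOfRecord F N p.K k).avg U) * (chiSeqOfRecord F N ν M g p.K k s'.init U * T' s'.init U))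
        (fieldMeasure (F.P p.K) k (SU N))) :
    ∃ (T : PBond (F.P p.K) (k + 1) → GaugeField (F.P p.K) k (SU N) → Set (SU N))
      (ϑ : PBond (F.P p.K) (k + 1) → GaugeField (F.P p.K) k (SU N) → SU N → SU N)
      (jd : PBond (F.P p.K) (k + 1) → GaugeField (F.P p.K) k (SU N) → SU N → ℝ≥0),
      (∀ c, MeasurableSet {q : GaugeField (F.P p.K) k (SU N) × SU N | q.2 ∈ T c q.1}) ∧
      (∀ c, Measurable fun q : GaugeField (F.P p.K) k (SU N) × SU N => ϑ c q.1 q.2) ∧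
      (∀ c, Measurable fun q : GaugeField (F.P p.K) k (SU N) × SU N => jd c q.1 q.2) ∧
      ∀ᵐ V' ∂(fieldMeasure (F.P p.K) (k + 1) (SU N)), ∀ s' : SeqOfRecord F ν M g p.K (k + 1),
        tstepOfRecord F N ν M w p g k T' s' V' =
          kernelRTOfRecord F N p.K k sV sV'
            (fun y => ∫ uin,
              (({z : ((↥sV → SU N) × ({c : PBond (F.P p.K) (k + 1) // c ∉ sV'} → SU N)) × ({b : PBond (F.P p.K) k // b ∉ sV} → SU N) |
                  ∀ c : {c : PBond (F.P p.K) (k + 1) // c ∉ sV'},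
                    z.1.2 c ∈ T c ((MeasurableEquiv.piEquivPiSubtypeProd (fun _ : PBond (F.P p.K) k => SU N) (· ∈ sV)).symm (z.1.1, z.2))}.indicator
                (fun z => ∏ c : {c : PBond (F.P p.K) (k + 1) // c ∉ sV'},
                  jd c ((MeasurableEquiv.piEquivPiSubtypeProd (fun _ : PBond (F.P p.K) k => SU N) (· ∈ sV)).symm (z.1.1, z.2)) (z.1.2 c))
                ((y, (MeasurableEquiv.piEquivPiSubtypeProd (fun _ : PBond (F.P p.K) (k + 1) => SU N) (· ∈ sV') V').2), uin) : ℝ≥0) : ℝ) *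
              ((fun U : GaugeField (F.P p.K) k (SU N) => w p g k s' U V' * (chiSeqOfRecord F N ν M g p.K k s'.init U * T' s'.init U))
                ((MeasurableEquiv.piEquivPiSubtypeProd (fun _ : PBond (F.P p.K) k => SU N) (· ∈ sV)).symm (y,
                  extend (fun c : {c : PBond (F.P p.K) (k + 1) // c ∉ sV'} =>
                      (⟨centralBond (c : PBond (F.P p.K) (k + 1)), hβ' c c.2⟩ : {b : PBond (F.P p.K) k // b ∉ sV}))
                    (fun c : {c : PBond (F.P p.K) (k + 1) // c ∉ sV'} =>
                      ϑ c ((MeasurableEquiv.piEquivPiSubtypeProd (fun _ : PBond (F.P p.K) k => SU N) (· ∈ sV)).symm (y, uin))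
                        ((MeasurableEquiv.piEquivPiSubtypeProd (fun _ : PBond (F.P p.K) (k + 1) => SU N) (· ∈ sV') V').2 c)) uin)))
              ∂(Measure.pi fun _ : {b : PBond (F.P p.K) k // b ∉ sV} => (HaarData.haar : Measure (SU N))))
            (MeasurableEquiv.piEquivPiSubtypeProd (fun _ : PBond (F.P p.K) (k + 1) => SU N) (· ∈ sV') V').1 :=
  exists_ae_forall_tstepOfRecord_eq_kernelRTOfRecord_innerCentralWindow p ν M w g hk T' hα0 hα hαδ hgap hY hsV hsV' hβ' hw hwj hχ hT
    (fun s' U V' h c hc i => loops_small_of_plaqSmallOn_blocks (succ_le_m_add_K hk) hδ hδα U c (hwq s' U V' h c hc) i) hGi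

end TStep

end Summit.QuantumFields.YangMills.Theorems.BalabanUVNodesN11TStepInnerCentralWindowChart

end
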